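import Mathlib
import Literature.MathematicalPhysics.QuantumFieldTheory.OSData
import Literature.MathematicalPhysics.QuantumFieldTheory.OSTimeAxisNullVector
import Literature.MathematicalPhysics.QuantumFieldTheory.OSTransferSelfImprovement
import Summits.QuantumFields.YangMills.Theorems.PencilRigidityCurvatureKernelBoundChartDerivativeBoundsTensor
import HarnessLib

/-!
# Crux `ContinuumLegGivenGap` (stmt-QuantumFields-15828), line `duality-selection-nlo-skewness`: the OS dictionary for the truncated two-point function

Helper toward the registered stub `stub_KLSep_of` (lead c15, reshape c15-1; blueprint
`Cruxes/ContinuumLegGivenGap/Lines/duality-selection-KL-blueprint.md`, item (P0)). For a labelled Schwinger family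
`S` satisfying the premises of the E1-free Osterwalder–Schrader reconstruction (`OSReconstructionNoE1`: E2 +
translations) and normalised (`𝔖₀ = 1`), and a species `s`, the VACUUM-SUBTRACTED field vector of a positive-time
one-point test function `G`,

  `ψ_G := Ψ_G − ⟪Ω, Ψ_G⟫ Ω`,  `Ψ_G = h.fieldVec 1 (fun _ => s) (G-lift)`,

carries the TRUNCATED two-point Schwinger function: `⟪ψ_F, ψ_G⟫ = 𝔖₂((F̄∘θ) ⊗ G) − 𝔖₁(F̄∘θ) 𝔖₁(G)`
(`inner_truncVec_truncVec`); Euclidean time translation acts by the contraction semigroup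
(`transfer_truncVec`); and `OSData.IsNontrivial` produces a positive-time one-point `G` with `ψ_G ≠ 0`
(`exists_truncVec_ne_zero`), whence `Re ⟪ψ_G, ψ_{G(·−ηe₀)}⟫ > 0` for every `η ≥ 0` (`re_inner_truncVec_translate_pos`,
by the tree's Laplace lemma `inner_transfer_self_re_pos`). Everything is proved; no definitions (the vector `ψ_G` is
written out).
-/

noncomputable section

namespace Summit.QuantumFields.YangMills.Cruxes.ContinuumLegGivenGap.DualitySelectionNloSkewness

open scoped SchwartzMap InnerProductSpace ComplexConjugate
open Filter Topology MeasureTheory Set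
open Literature.MathematicalPhysics.QuantumFieldTheory Literature.MathematicalPhysics.QuantumLattice
  Literature.MathematicalPhysics.AQFT
open Summit.QuantumFields.YangMills.Theorems.CurvatureKernel

variable {ι : Type} {d : ℕ} [NeZero d]

/-! ### One-point lifts -/

omit [NeZero d] in
/-- Every degree-one test function is the lift of a one-point test function. [folklore] -/
theorem exists_eq_tensorFin_one (G : 𝓢((Fin 1 → EuclideanSpace ℝ (Fin d)), ℂ)) :
    ∃ G₁ : 𝓢(EuclideanSpace ℝ (Fin d), ℂ), G = SchwartzMap.tensorFin 1 ![G₁] := by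
  refine ⟨SchwartzMap.compCLMOfContinuousLinearEquiv ℂ
    (ContinuousLinearEquiv.funUnique (Fin 1) ℝ (EuclideanSpace ℝ (Fin d))).symm G, ?_⟩
  ext x
  rw [tensorFin_one_eval, SchwartzMap.compCLMOfContinuousLinearEquiv_apply, Function.comp_apply]
  congr 1
  funext i
  rw [Subsingleton.elim i 0]
  rfl

/-- The one-point profile of a time-ordered degree-one test function is positive-time. [folklore] -/
theorem tsupport_subset_pos_of_isTimeOrdered_tensorFin_one {G₁ : 𝓢(EuclideanSpace ℝ (Fin d), ℂ)}
    (hG : IsTimeOrdered (SchwartzMap.tensorFin 1 ![G₁])) :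
    tsupport (G₁ : EuclideanSpace ℝ (Fin d) → ℂ) ⊆ {y | 0 < y 0} := by
  intro y hy
  -- `y ↦ (fun _ => y)` is continuous and maps the support of `G₁` into the support of the lift
  set e : EuclideanSpace ℝ (Fin d) → (Fin 1 → EuclideanSpace ℝ (Fin d)) := fun y _ => y with he
  have hec : Continuous e := continuous_pi fun _ => continuous_id
  have hsub : Function.support (G₁ : EuclideanSpace ℝ (Fin d) → ℂ) ⊆
      e ⁻¹' tsupport ((SchwartzMap.tensorFin 1 ![G₁] : 𝓢((Fin 1 → EuclideanSpace ℝ (Fin d)), ℂ)) :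
        (Fin 1 → EuclideanSpace ℝ (Fin d)) → ℂ) := by
    intro z hz
    refine subset_tsupport _ ?_
    rw [Function.mem_support] at hz ⊢
    rwa [tensorFin_one_eval]
  have hmem : e y ∈ tsupport ((SchwartzMap.tensorFin 1 ![G₁] : 𝓢((Fin 1 → EuclideanSpace ℝ (Fin d)), ℂ)) :
      (Fin 1 → EuclideanSpace ℝ (Fin d)) → ℂ) :=
    closure_minimal hsub ((isClosed_tsupport _).preimage hec) hy
  exact (hG hmem).1 0

/-- Time-ordering of the lift of a positive-time translate. [folklore] -/
theorem tsupport_compSubConstCLM_subset_pos {G₁ : 𝓢(EuclideanSpace ℝ (Fin d), ℂ)}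
    (hG₁ : tsupport (G₁ : EuclideanSpace ℝ (Fin d) → ℂ) ⊆ {y | 0 < y 0}) {a : EuclideanSpace ℝ (Fin d)}
    (ha : 0 ≤ a 0) :
    tsupport ((SchwartzMap.compSubConstCLM ℂ a G₁ : 𝓢(EuclideanSpace ℝ (Fin d), ℂ)) :
      EuclideanSpace ℝ (Fin d) → ℂ) ⊆ {y | 0 < y 0} := by
  intro y hy
  have h := hG₁ (sub_mem_tsupport_of_mem_tsupport_compSubConstCLM a G₁ hy)
  simp only [mem_setOf_eq, PiLp.sub_apply] at h
  simp only [mem_setOf_eq]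
  linarith

/-- The label string `rev k ++ k` of the two-point pairing is the constant string. [folklore] -/
theorem append_const_rev_const (s : ι) :
    Fin.append ((fun _ : Fin 1 => s) ∘ Fin.rev) (fun _ : Fin 1 => s) = fun _ : Fin (1 + 1) => s := by
  funext i
  refine Fin.addCases (fun j => ?_) (fun j => ?_) i
  · rw [Fin.append_left]; rfl
  · rw [Fin.append_right]

/-- The OS adjoint of a one-point lift is the lift of `conj ∘ F ∘ θ`. [folklore] -/
theorem osAdjoint_tensorFin_one_eq (F₁ : 𝓢(EuclideanSpace ℝ (Fin d), ℂ)) :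
    osAdjoint (SchwartzMap.tensorFin 1 ![F₁]) = SchwartzMap.tensorFin 1 ![starTest (thetaTest d F₁)] := by
  ext x
  rw [osAdjoint_tensorFin_one_apply, tensorFin_one_eval, starTest_thetaTest_apply]

omit [NeZero d] in
/-- Time translation of a one-point lift is the lift of the translate. [folklore] -/
theorem translateMulti_tensorFin_one (a : EuclideanSpace ℝ (Fin d)) (G₁ : 𝓢(EuclideanSpace ℝ (Fin d), ℂ)) :
    translateMulti a (SchwartzMap.tensorFin 1 ![G₁]) =
      SchwartzMap.tensorFin 1 ![SchwartzMap.compSubConstCLM ℂ a G₁] := by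
  ext x
  rw [translateMulti_apply, tensorFin_one_eval, tensorFin_one_eval, SchwartzMap.compSubConstCLM_apply]

/-! ### The dictionary -/

variable {S : LabelledSchwingerFamily ι (EuclideanSpace ℝ (Fin d))}

variable (h : OSReconstructionNoE1 S)

/-- Field vectors do not depend on the presentation of the test function. [folklore] -/
theorem fieldVec_congr {n : ℕ} (k : Fin n → ι) {F F' : 𝓢((Fin n → EuclideanSpace ℝ (Fin d)), ℂ)}
    (hF : IsTimeOrdered F) (hF' : IsTimeOrdered F') (hFF' : F = F') :
    h.fieldVec n k F hF = h.fieldVec n k F' hF' := by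
  subst hFF'
  rfl

/-- The vacuum component is unchanged by time translation (`e^{-tH}` is symmetric and fixes `Ω`). [folklore] -/
theorem inner_vacuum_transfer (t : ℝ) (Φ : h.Hilbert) :
    ⟪h.vacuum, h.transfer t Φ⟫_ℂ = ⟪h.vacuum, Φ⟫_ℂ := by
  rw [← h.inner_transfer_left, h.transfer_vacuum]

/-- **`e^{-tH}` on vacuum-subtracted vectors**: `e^{-tH}(Φ − ⟪Ω,Φ⟫Ω) = e^{-tH}Φ − ⟪Ω, e^{-tH}Φ⟫Ω`. [folklore] -/
theorem transfer_sub_vacuumComponent (t : ℝ) (Φ : h.Hilbert) :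
    h.transfer t (Φ - ⟪h.vacuum, Φ⟫_ℂ • h.vacuum) =
      h.transfer t Φ - ⟪h.vacuum, h.transfer t Φ⟫_ℂ • h.vacuum := by
  rw [map_sub, map_smul, h.transfer_vacuum, inner_vacuum_transfer h]

/-- **Inner products of vacuum-subtracted vectors**: with `‖Ω‖ = 1`,
`⟪Φ − ⟪Ω,Φ⟫Ω, Φ' − ⟪Ω,Φ'⟫Ω⟫ = ⟪Φ, Φ'⟫ − ⟪Φ, Ω⟫⟪Ω, Φ'⟫`. [folklore] -/
theorem inner_sub_vacuumComponent (h0 : S.IsNormalized) (Φ Φ' : h.Hilbert) :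
    ⟪Φ - ⟪h.vacuum, Φ⟫_ℂ • h.vacuum, Φ' - ⟪h.vacuum, Φ'⟫_ℂ • h.vacuum⟫_ℂ =
      ⟪Φ, Φ'⟫_ℂ - ⟪Φ, h.vacuum⟫_ℂ * ⟪h.vacuum, Φ'⟫_ℂ := by
  have hΩ : ⟪h.vacuum, h.vacuum⟫_ℂ = 1 := by
    rw [inner_self_eq_norm_sq_to_K, h.norm_vacuum h0]; simp
  rw [inner_sub_left, inner_sub_right, inner_sub_right, inner_smul_left, inner_smul_left, inner_smul_right,
    inner_smul_right, hΩ, inner_conj_symm]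
  ring

/-- A vacuum-subtracted vector vanishes iff the vector is a multiple of the vacuum; in that case its pairings
factor through the vacuum. [folklore] -/
theorem inner_eq_of_sub_vacuumComponent_eq_zero {Φ Φ' : h.Hilbert}
    (hΦ' : Φ' - ⟪h.vacuum, Φ'⟫_ℂ • h.vacuum = 0) :
    ⟪Φ, Φ'⟫_ℂ = ⟪Φ, h.vacuum⟫_ℂ * ⟪h.vacuum, Φ'⟫_ℂ := by
  have h1 : Φ' = ⟪h.vacuum, Φ'⟫_ℂ • h.vacuum := (sub_eq_zero.1 hΦ')
  conv_lhs => rw [h1]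
  rw [inner_smul_right, mul_comm]

/-- **The truncated two-point function as an inner product of vacuum-subtracted field vectors.** For positive-time
one-point `F, G` and `ψ_X := Ψ_X − ⟪Ω, Ψ_X⟫Ω`:
`⟪ψ_F, ψ_G⟫ = 𝔖₂^{ss}((conj∘F∘θ) ⊗ G) − 𝔖₁^s(conj∘F∘θ) · 𝔖₁^s(G)`. [folklore] -/
theorem inner_truncVec_truncVec (h : OSReconstructionNoE1 S) (h0 : S.IsNormalized) (s : ι)
    {F₁ G₁ : 𝓢(EuclideanSpace ℝ (Fin d), ℂ)}
    (hF₁ : tsupport (F₁ : EuclideanSpace ℝ (Fin d) → ℂ) ⊆ {y | 0 < y 0})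
    (hG₁ : tsupport (G₁ : EuclideanSpace ℝ (Fin d) → ℂ) ⊆ {y | 0 < y 0}) :
    ⟪h.fieldVec 1 (fun _ => s) (SchwartzMap.tensorFin 1 ![F₁]) (isTimeOrdered_tensorFin_one hF₁) -
        ⟪h.vacuum, h.fieldVec 1 (fun _ => s) (SchwartzMap.tensorFin 1 ![F₁]) (isTimeOrdered_tensorFin_one hF₁)⟫_ℂ •
          h.vacuum,
      h.fieldVec 1 (fun _ => s) (SchwartzMap.tensorFin 1 ![G₁]) (isTimeOrdered_tensorFin_one hG₁) -
        ⟪h.vacuum, h.fieldVec 1 (fun _ => s) (SchwartzMap.tensorFin 1 ![G₁]) (isTimeOrdered_tensorFin_one hG₁)⟫_ℂ •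
          h.vacuum⟫_ℂ =
      S 2 (fun _ => s) (SchwartzMap.tensorFin 2 ![starTest (thetaTest d F₁), G₁]) -
        S 1 (fun _ => s) (SchwartzMap.tensorFin 1 ![starTest (thetaTest d F₁)]) *
          S 1 (fun _ => s) (SchwartzMap.tensorFin 1 ![G₁]) := by
  rw [inner_sub_vacuumComponent h h0, h.inner_fieldVec_fieldVec (fun _ => s) (fun _ => s)
      (isTimeOrdered_tensorFin_one hF₁) (isTimeOrdered_tensorFin_one hG₁) (isAppendTensorOf_conjTheta F₁ G₁),
    h.inner_fieldVec_vacuum, h.inner_vacuum_fieldVec, append_const_rev_const, osAdjoint_tensorFin_one_eq]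
  rfl

/-- **Euclidean time translation of vacuum-subtracted one-point field vectors**: for `t ≥ 0`,
`e^{-tH} ψ_G = ψ_{G(· − t e₀)}`. [folklore] -/
theorem transfer_truncVec (h : OSReconstructionNoE1 S) (s : ι) {G₁ : 𝓢(EuclideanSpace ℝ (Fin d), ℂ)}
    (hG₁ : tsupport (G₁ : EuclideanSpace ℝ (Fin d) → ℂ) ⊆ {y | 0 < y 0}) {t : ℝ} (ht : 0 ≤ t) :
    h.transfer t (h.fieldVec 1 (fun _ => s) (SchwartzMap.tensorFin 1 ![G₁]) (isTimeOrdered_tensorFin_one hG₁) -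
        ⟪h.vacuum, h.fieldVec 1 (fun _ => s) (SchwartzMap.tensorFin 1 ![G₁]) (isTimeOrdered_tensorFin_one hG₁)⟫_ℂ •
          h.vacuum) =
      h.fieldVec 1 (fun _ => s) (SchwartzMap.tensorFin 1 ![SchwartzMap.compSubConstCLM ℂ (EuclideanSpace.single 0 t) G₁])
          (isTimeOrdered_tensorFin_one (tsupport_compSubConstCLM_subset_pos hG₁
            (by simpa using ht))) -
        ⟪h.vacuum, h.fieldVec 1 (fun _ => s)
            (SchwartzMap.tensorFin 1 ![SchwartzMap.compSubConstCLM ℂ (EuclideanSpace.single 0 t) G₁])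
            (isTimeOrdered_tensorFin_one (tsupport_compSubConstCLM_subset_pos hG₁
              (by simpa using ht)))⟫_ℂ • h.vacuum := by
  have key : h.transfer t (h.fieldVec 1 (fun _ => s) (SchwartzMap.tensorFin 1 ![G₁]) (isTimeOrdered_tensorFin_one hG₁)) =
      h.fieldVec 1 (fun _ => s) (SchwartzMap.tensorFin 1 ![SchwartzMap.compSubConstCLM ℂ (EuclideanSpace.single 0 t) G₁])
        (isTimeOrdered_tensorFin_one (tsupport_compSubConstCLM_subset_pos hG₁
          (by simpa using ht))) := by
    rw [h.transfer_fieldVec ht]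
    exact fieldVec_congr h _ _ _ (translateMulti_tensorFin_one _ _)
  rw [transfer_sub_vacuumComponent h, key]

variable (T : OSData ι d)

/-- **Non-triviality gives a non-vanishing vacuum-subtracted one-point field vector**: if `φ_s` is not a
c-number (`OSData.IsNontrivial`), some positive-time one-point `G` has `ψ_G ≠ 0`. [folklore] -/
theorem exists_truncVec_ne_zero (s : ι) (hNT : T.IsNontrivial s) :
    ∃ (G₁ : 𝓢(EuclideanSpace ℝ (Fin d), ℂ)) (hG₁ : tsupport (G₁ : EuclideanSpace ℝ (Fin d) → ℂ) ⊆ {y | 0 < y 0}),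
      (OSReconstructionNoE1.of_osAxioms T.osAxioms).fieldVec 1 (fun _ => s) (SchwartzMap.tensorFin 1 ![G₁])
          (isTimeOrdered_tensorFin_one hG₁) -
        ⟪(OSReconstructionNoE1.of_osAxioms T.osAxioms).vacuum,
          (OSReconstructionNoE1.of_osAxioms T.osAxioms).fieldVec 1 (fun _ => s) (SchwartzMap.tensorFin 1 ![G₁])
            (isTimeOrdered_tensorFin_one hG₁)⟫_ℂ • (OSReconstructionNoE1.of_osAxioms T.osAxioms).vacuum ≠ 0 := by
  set h := OSReconstructionNoE1.of_osAxioms T.osAxioms with hh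
  obtain ⟨F, G, H, hF, hG, hH, hne⟩ := hNT
  obtain ⟨G₁, rfl⟩ := exists_eq_tensorFin_one G
  have hG₁ : tsupport (G₁ : EuclideanSpace ℝ (Fin d) → ℂ) ⊆ {y | 0 < y 0} :=
    tsupport_subset_pos_of_isTimeOrdered_tensorFin_one hG
  refine ⟨G₁, hG₁, fun hzero => hne ?_⟩
  -- the pairing factors through the vacuum
  have hinner := h.inner_fieldVec_fieldVec (fun _ => s) (fun _ => s) hF hG hH
  rw [append_const_rev_const] at hinner
  have hfac := inner_eq_of_sub_vacuumComponent_eq_zero h (Φ := h.fieldVec 1 (fun _ => s) F hF) hzero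
  rw [h.inner_fieldVec_vacuum, h.inner_vacuum_fieldVec] at hfac
  change T.schwinger (1 + 1) (fun _ => s) H = _
  rw [← hinner]
  exact hfac

/-- **Strict positivity along the time axis**: if `ψ_G ≠ 0` then `Re ⟪ψ_G, ψ_{G(·−ηe₀)}⟫ > 0` for every `η ≥ 0`
(it is `Re ⟪ψ_G, e^{-ηH} ψ_G⟫`, a Laplace transform of a non-zero positive measure). [folklore] -/
theorem re_inner_truncVec_translate_pos (h : OSReconstructionNoE1 S) (s : ι)
    {G₁ : 𝓢(EuclideanSpace ℝ (Fin d), ℂ)}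
    (hG₁ : tsupport (G₁ : EuclideanSpace ℝ (Fin d) → ℂ) ⊆ {y | 0 < y 0})
    (hne : h.fieldVec 1 (fun _ => s) (SchwartzMap.tensorFin 1 ![G₁]) (isTimeOrdered_tensorFin_one hG₁) -
        ⟪h.vacuum, h.fieldVec 1 (fun _ => s) (SchwartzMap.tensorFin 1 ![G₁]) (isTimeOrdered_tensorFin_one hG₁)⟫_ℂ •
          h.vacuum ≠ 0)
    {η : ℝ} (hη : 0 ≤ η) :
    0 < (⟪h.fieldVec 1 (fun _ => s) (SchwartzMap.tensorFin 1 ![G₁]) (isTimeOrdered_tensorFin_one hG₁) -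
        ⟪h.vacuum, h.fieldVec 1 (fun _ => s) (SchwartzMap.tensorFin 1 ![G₁]) (isTimeOrdered_tensorFin_one hG₁)⟫_ℂ •
          h.vacuum,
      h.fieldVec 1 (fun _ => s) (SchwartzMap.tensorFin 1 ![SchwartzMap.compSubConstCLM ℂ (EuclideanSpace.single 0 η) G₁])
          (isTimeOrdered_tensorFin_one (tsupport_compSubConstCLM_subset_pos hG₁
            (by simpa using hη))) -
        ⟪h.vacuum, h.fieldVec 1 (fun _ => s)
            (SchwartzMap.tensorFin 1 ![SchwartzMap.compSubConstCLM ℂ (EuclideanSpace.single 0 η) G₁])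
            (isTimeOrdered_tensorFin_one (tsupport_compSubConstCLM_subset_pos hG₁
              (by simpa using hη)))⟫_ℂ • h.vacuum⟫_ℂ).re := by
  rw [← transfer_truncVec h s hG₁ hη]
  exact h.inner_transfer_self_re_pos hne hη

end Summit.QuantumFields.YangMills.Cruxes.ContinuumLegGivenGap.DualitySelectionNloSkewness

end
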